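import Mathlib
import Summits.Langlands.Langlands.Theorems.IwahoriTransientShapingOfHost
import Summits.Langlands.Langlands.Theses.RootDecomp1
import Literature.NumberTheory.Automorphic.CarayolCompatibilityOfLocalGlobalProofs
import Literature.NumberTheory.Automorphic.UnramifiedOrbitSetSplit
import Literature.NumberTheory.Automorphic.LocalComponentBJProofs
import Literature.NumberTheory.Automorphic.LocalComponentBJExistsProofs
import Literature.NumberTheory.Automorphic.HarishChandraFinitenessGL
import Literature.NumberTheory.Automorphic.IwahoriGL
import Literature.NumberTheory.GaloisRepresentations.WeilDeligneSemisimpleTraces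
import Literature.NumberTheory.GaloisRepresentations.WeilDeligneRepFrobSemisimpleProofs

/-!
# DAG edge — part 4: the SEMISIMPLE host `IwahoriDictionary (S5) ⟸ CRD ∧ P(i) ∧ SSM ∧ IWD-A ∧ IWD-B1a ∧ IWD-B1b ∧ IWD-B2`
(decomp-langlands, lens-3 gen 27, addendum; v2 cells: IWD-A / IWD-B1a carry the cuspidal local-component hypothesis, crit-1 row 430)

Part 2 (`IwahoriTransientDictionaryEdge`) derived S5 from the N0 host items CRD, P(i) and the FULL local–global compatibility L∤R
(`PrimeSwitchSplit.CompatibilityAwayFromLR`, 18084).  This part replaces L∤R by its Weil-group half SSM =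
`RootDecomp1.SemisimpleMatchingOneDatum` (stmt-Langlands-23600: at an exceptional place `v ∤ ℓ`, a Frobenius-semisimple `S ∈ rec_v(π_v)` with the
traces of `ι WD_v(ρ')`); the Satake-compatible places use TREE THEOREMS only (Flath existence `exists_hasLocalComponentAt_of_isAdmissible` with
`automorphicRep_isAdmissible_holds` = Harish-Chandra finiteness, `hasLocalComponentAt_spherical_of_hasSatakeParamAt_holds`, `iwahoriGL_le_glInt`).  New kernel content:
`charpoly ρ'(Frob)` = `charpoly [r.ρ w]` through the recipe for any monodromy (§F), the `q_v`-pair transported from a complex matching partner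
through Frobenius-semisimplification, Brauer–Nesbitt (`nonempty_equiv_of_isFrobSemisimple_of_trace_eq`) and `ι`, and the upgrade "traces + both
monodromies zero ⇒ full compatibility at `v`".  Sorry-free; axioms standard.
-/

set_option linter.dupNamespace false
set_option linter.unusedVariables false
set_option linter.unusedSectionVars false

namespace Summit.Langlands.Langlands.Theorems.IwahoriTransient

open scoped Polynomial Matrix Pointwise
open Polynomial

namespace DictEdge

/-! ## §F. The SEMISIMPLE host: `S5 ⟸ CRD ∧ P(i) ∧ SSM ∧ IWD-A ∧ IWD-B1a ∧ IWD-B1b ∧ IWD-B2`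

`SSM = RootDecomp1.SemisimpleMatchingOneDatum` (stmt-Langlands-23600) is the WEIL-GROUP HALF of L∤R: at an exceptional place `v ∤ ℓ` it returns
a Frobenius-semisimple `S ∈ rec_v(π_v)` with the TRACES of `ι WD_v(ρ')`, not its monodromy.  S5 needs no more: (i) `S.ρ|_I = 1` because
equal traces make `S.ρ ≅ (ι WD_v(ρ'))^{F-ss}.ρ` (Brauer–Nesbitt in characteristic zero, tree `nonempty_equiv_of_isFrobSemisimple_of_trace_eq`)
and the latter is trivial on inertia (§B); (ii) if `N(WD_v ρ') ≠ 0` the `q_v`-pair is Galois-side algebra (§D); if `N(WD_v ρ') = 0 ≠ N_S` the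
`q_v`-pair of `S.ρ(Φ)` (§A over `ℂ`) is a pair of roots of `charpoly ρ'(Frob)` because F-semisimplification, `≅` and `ι` preserve characteristic
polynomials; if both vanish, `(ι WD_v ρ')^{F-ss} ≅ S` as Weil–Deligne representations, i.e. FULL local–global compatibility holds at `v`, and
IWD-B1a/B1b/B2 give Satake compatibility — contradicting the exceptional hypothesis of SSM.  At the non-exceptional places the Iwahori vector
comes from TREE THEOREMS: Flath existence of the local component (`exists_hasLocalComponentAt_of_isAdmissible` + Borel–Jacquet admissibility
`automorphicRep_isAdmissible_holds`, i.e. Harish-Chandra finiteness, all PROVED) and `hasLocalComponentAt_spherical_of_hasSatakeParamAt_holds`. -/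

section SemisimpleHost

open Literature.NumberTheory.GaloisRepresentations Literature.NumberTheory.Automorphic IsDedekindDomain
open Summit.Langlands.Langlands.Theses.PrimeSwitchSplit

/-- Two distinct roots form a sub-multiset of the root multiset. -/
theorem pair_le_roots {R : Type*} [CommRing R] [IsDomain R] {p : R[X]} (hp : p ≠ 0) {a b : R}
    (ha : p.IsRoot a) (hb : p.IsRoot b) (hab : a ≠ b) : ({a, b} : Multiset R) ≤ p.roots := by
  rw [Multiset.le_iff_subset (by simp [hab])]
  intro x hx
  simp only [Multiset.insert_eq_cons, Multiset.mem_cons, Multiset.mem_singleton] at hx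
  rcases hx with rfl | rfl
  · exact (Polynomial.mem_roots hp).mpr ha
  · exact (Polynomial.mem_roots hp).mpr hb

section WeilMatrices

variable {F : Type} [Field F] [ValuativeRel F] [TopologicalSpace F] [IsNonarchimedeanLocalField F]
variable {C : Type} [Field C] [CharZero C] {n : ℕ}

/-- The Weil–Deligne relation at an element of degree `1`, as matrices: `[ρ w] [N] = q • [N] [ρ w]`. -/
theorem toMatrix'_rel_of_deg_one (S : WeilDeligneRep F C (Fin n → C)) {w : WeilGroup F} (hw : WeilGroup.deg w = 1) :
    LinearMap.toMatrix' (S.ρ w) * LinearMap.toMatrix' S.N =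
      (IsNonarchimedeanLocalField.residueFieldCard F : C) • (LinearMap.toMatrix' S.N * LinearMap.toMatrix' (S.ρ w)) := by
  have hc := S.conj_N w
  rw [hw, zpow_one] at hc
  have := congrArg LinearMap.toMatrix' hc
  rw [LinearMap.toMatrix'_comp, LinearEquiv.map_smul, LinearMap.toMatrix'_comp] at this
  exact this

/-- `[ρ w]` is invertible. -/
theorem isUnit_toMatrix'_ρ (S : WeilDeligneRep F C (Fin n → C)) (w : WeilGroup F) : IsUnit (LinearMap.toMatrix' (S.ρ w)) := by
  have h2 : LinearMap.toMatrix' (S.ρ w) * LinearMap.toMatrix' (S.ρ w⁻¹) = 1 := by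
    rw [← LinearMap.toMatrix'_mul, ← map_mul, mul_inv_cancel, map_one, LinearMap.toMatrix'_one]
  have hdet : (LinearMap.toMatrix' (S.ρ w)).det * (LinearMap.toMatrix' (S.ρ w⁻¹)).det = 1 := by
    rw [← Matrix.det_mul, h2, Matrix.det_one]
  exact (Matrix.isUnit_iff_isUnit_det _).mpr
    (isUnit_iff_ne_zero.mpr fun h0 => zero_ne_one (by rw [h0, zero_mul] at hdet; exact hdet))

/-- The characteristic polynomial of `[f]` (standard basis) is the basis-free `LinearMap.charpoly f`. -/
theorem charpoly_toMatrix'_eq (f : Module.End C (Fin n → C)) : (LinearMap.toMatrix' f).charpoly = f.charpoly := by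
  rw [← LinearMap.toMatrix_eq_toMatrix', LinearMap.charpoly_toMatrix]

end WeilMatrices

/-- **Characteristic polynomial of Frobenius through the recipe.**  If `r` is attached to `ρ'|_{Γ_v}` by the Grothendieck–Deligne recipe and
`r.ρ` is trivial on inertia, then for every `𝔓 ∣ v` and every arithmetic Frobenius `σ` at `𝔓` there is `w ∈ W_{K_v}` of degree `1` with
`charpoly ρ'(σ) = charpoly [r.ρ w]` (Galois conjugation to `𝔓₀ = adicCompletionPrime`, then §A kills the factor `exp(sN)`).  [new] -/
theorem charpoly_frob_eq_charpoly_weil {K : Type} [Field K] [NumberField K] {ℓ : ℕ} [Fact ℓ.Prime] {n : ℕ}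
    (ρ' : FramedGaloisRep K (PadicAlgCl ℓ) n) (v : HeightOneSpectrum (NumberField.RingOfIntegers K))
    (r : WeilDeligneRep (v.adicCompletion K) (PadicAlgCl ℓ) (Fin n → PadicAlgCl ℓ))
    (hrec : IsWeilDeligneOfLadic ((ρ'.toLocal v).toWeilGroupHom) r)
    (hI : ∀ u ∈ WeilGroup.inertia (v.adicCompletion K), r.ρ u = 1)
    {𝔓 : Ideal (absIntegers (NumberField.RingOfIntegers K) K)} (h𝔓 : 𝔓 ∈ v.primesAbove)
    {σ : Field.absoluteGaloisGroup K} (hσ : IsArithFrobAt (NumberField.RingOfIntegers K) σ 𝔓) :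
    ∃ w : WeilGroup (v.adicCompletion K), WeilGroup.deg w = 1 ∧
      FramedRep.charpoly ρ' σ = (LinearMap.toMatrix' (r.ρ w)).charpoly := by
  have hmul : IsFrobPow.mul (F := v.adicCompletion K) := IsFrobPow.mul_holds
  have huniq : IsFrobPow.unique (F := v.adicCompletion K) := IsFrobPow.unique_holds
  obtain ⟨g, rfl⟩ := HeightOneSpectrum.exists_smul_eq_of_mem_primesAbove_holds (adicCompletionPrime_mem_primesAbove K v) h𝔓
  have hσ₀ : IsArithFrobAt (NumberField.RingOfIntegers K) (g⁻¹ * σ * g) (adicCompletionPrime K v) := by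
    have := hσ.conj g⁻¹
    simpa only [inv_inv, inv_smul_smul] using this
  have hmem : g⁻¹ * σ * g ∈ (absGaloisRestrict K (v.adicCompletion K)).range := by
    rw [← decompositionSubgroup_adicCompletionPrime_eq_range]
    exact hσ₀.mem_stabilizer
  obtain ⟨σl, hσl⟩ := hmem
  have hσl' : absGaloisRestrict K (v.adicCompletion K) σl = g⁻¹ * σ * g := hσl
  have hq : IsNonarchimedeanLocalField.residueFieldCard (v.adicCompletion K) = Nat.card (NumberField.RingOfIntegers K ⧸ v.asIdeal) := by
    rw [residueFieldCard_adicCompletion_eq, HeightOneSpectrum.residueCard_eq_card_quotient]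
  have hFrob : IsAbsArithFrob σl :=
    (isArithFrobAt_absGaloisRestrict_adicCompletionPrime_iff K v hq σl).mp (by rw [hσl']; exact hσ₀)
  have h1 : IsFrobPow σl 1 := isFrobPow_one_iff_isAbsArithFrob_holds.mpr hFrob
  set w : WeilGroup (v.adicCompletion K) := WeilGroup.mk σl ⟨1, h1⟩ with hw
  have hdegw : WeilGroup.deg w = 1 :=
    (WeilGroup.deg_eq_iff hmul huniq).mpr (by rw [hw, WeilGroup.toAbsGalois_mk]; exact h1)
  have hval : ρ' (g⁻¹ * σ * g) = (ρ'.toLocal v).toWeilGroupHom w := by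
    rw [FramedRep.toWeilGroupHom_apply, FramedGaloisRep.toLocal_apply, hw, WeilGroup.toAbsGalois_mk]
    exact congrArg ρ' hσl'.symm
  obtain ⟨t, U, Φ, hUI, hUo, hΦ, ht, hU, hρ⟩ := hrec
  set Nm : Matrix (Fin n) (Fin n) (PadicAlgCl ℓ) := LinearMap.toMatrix' r.N with hNm
  have hNmn : IsNilpotent Nm := r.isNilpotent_N.map LinearMap.toMatrixAlgEquiv'
  have hu : Φ * w ∈ WeilGroup.inertia (v.adicCompletion K) := by
    rw [← WeilGroup.deg_eq_zero_iff_mem_inertia hmul huniq, WeilGroup.deg_mul hmul huniq, hΦ, hdegw]; norm_num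
  have e1 : Φ ^ (-1 : ℤ) * (Φ * w) = w := by rw [zpow_neg_one, inv_mul_cancel_left]
  set s : PadicAlgCl ℓ := (t ⟨Φ * w, hu⟩).toAdd with hs
  have key : LinearMap.toMatrix' (r.ρ (Φ ^ (-1 : ℤ) * (Φ * w))) =
      (((ρ'.toLocal v).toWeilGroupHom (Φ ^ (-1 : ℤ) * (Φ * w)) : GL (Fin n) (PadicAlgCl ℓ)) : Matrix (Fin n) (Fin n) (PadicAlgCl ℓ)) *
        IsNilpotent.exp (-(s • Nm)) := hρ (-1) ⟨Φ * w, hu⟩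
  rw [e1] at key
  set A : Matrix (Fin n) (Fin n) (PadicAlgCl ℓ) := LinearMap.toMatrix' (r.ρ w) with hA
  have hsN : IsNilpotent (s • Nm) := hNmn.smul s
  have hM : (((ρ'.toLocal v).toWeilGroupHom w : GL (Fin n) (PadicAlgCl ℓ)) : Matrix (Fin n) (Fin n) (PadicAlgCl ℓ)) =
      A * IsNilpotent.exp (s • Nm) := by
    have e2 : IsNilpotent.exp (-(s • Nm)) * IsNilpotent.exp (s • Nm) = 1 := IsNilpotent.exp_neg_mul_exp_self hsN
    rw [key, mul_assoc, e2, mul_one]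
  set q : ℕ := IsNonarchimedeanLocalField.residueFieldCard (v.adicCompletion K) with hqdef
  have hAN : A * Nm = (q : PadicAlgCl ℓ) • (Nm * A) := toMatrix'_rel_of_deg_one r hdegw
  have hAunit : IsUnit A := isUnit_toMatrix'_ρ r w
  have hq1 : 1 < q := IsNonarchimedeanLocalField.one_lt_residueFieldCard _
  have hq0 : (q : PadicAlgCl ℓ) ≠ 0 := Nat.cast_ne_zero.mpr (by omega)
  have hqk : ∀ k : ℕ, 0 < k → (q : PadicAlgCl ℓ) ^ k ≠ 1 := by
    intro k hk h
    have : (q ^ k : ℕ) = 1 := by exact_mod_cast h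
    exact (Nat.one_lt_pow hk.ne' hq1).ne' this
  refine ⟨w, hdegw, ?_⟩
  have eσ : σ = g * (g⁻¹ * σ * g) * g⁻¹ := by group
  rw [FramedRep.charpoly, eσ, map_mul, map_mul, map_inv, Units.val_mul, Units.val_mul, Matrix.coe_units_inv,
    Matrix.charpoly_units_conj, hval, hM, charpoly_mul_exp_smul A Nm hAunit hNmn hq0 hqk hAN s]

/-- **The `q_v`-pair read off a complex Frobenius-semisimple matching partner.**  Let `W` (coefficients `ℚ̄_ℓ`) be transported along `ι` to `Wℂ`,
`rss` a Frobenius-semisimplification of `Wℂ`, `e : rss.ρ ≅ S.ρ` an isomorphism of Weil-group representations onto a Weil–Deligne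
representation `S` with `N_S ≠ 0`, and `w` of degree `1`.  Then `charpoly [W.ρ w]` has an exact `q_v`-pair of roots: the pair `μ, q μ`
of `[S.ρ w]` (§A, from `[S.ρ w][N_S] = q [N_S][S.ρ w]`) pulled back through `charpoly [S.ρ w] = charpoly [rss.ρ w]` (conjugation),
`= charpoly [Wℂ.ρ w]` (a commuting nilpotent perturbation does not change `charpoly`) `= ι (charpoly [W.ρ w])`.  [new] -/
theorem qpair_of_complex_partner {K : Type} [Field K] [NumberField K] {ℓ : ℕ} [Fact ℓ.Prime] {n : ℕ} (ι : PadicAlgCl ℓ ≃+* ℂ)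
    {v : HeightOneSpectrum (NumberField.RingOfIntegers K)}
    (W : WeilDeligneRep (v.adicCompletion K) (PadicAlgCl ℓ) (Fin n → PadicAlgCl ℓ))
    (Wℂ rss S : WeilDeligneRep (v.adicCompletion K) ℂ (Fin n → ℂ))
    (htrans : W.IsTransportAlong (ι : PadicAlgCl ℓ →+* ℂ) Wℂ) (hss : rss.IsFrobSemisimplificationOf Wℂ)
    (e : rss.ρ.Equiv S.ρ) (hNS : S.N ≠ 0) {w : WeilGroup (v.adicCompletion K)} (hw : WeilGroup.deg w = 1) :
    ∃ a b : PadicAlgCl ℓ, ({a, b} : Multiset (PadicAlgCl ℓ)) ≤ ((LinearMap.toMatrix' (W.ρ w)).charpoly).roots ∧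
      a = (v.residueCard : PadicAlgCl ℓ) * b := by
  set q : ℕ := IsNonarchimedeanLocalField.residueFieldCard (v.adicCompletion K) with hqdef
  have hq1 : 1 < q := IsNonarchimedeanLocalField.one_lt_residueFieldCard _
  set p : (PadicAlgCl ℓ)[X] := (LinearMap.toMatrix' (W.ρ w)).charpoly with hp
  have hp0 : p ≠ 0 := (Matrix.charpoly_monic _).ne_zero
  -- (α) transport along `ι`
  have hα : (LinearMap.toMatrix' (Wℂ.ρ w)).charpoly = p.map (ι : PadicAlgCl ℓ →+* ℂ) := by
    rw [htrans.1 w, Matrix.charpoly_map]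
  -- (β) Frobenius-semisimplification: `Wℂ.ρ w = rss.ρ w + nn`, `nn` nilpotent commuting
  have hβ : (LinearMap.toMatrix' (Wℂ.ρ w)).charpoly = (LinearMap.toMatrix' (rss.ρ w)).charpoly := by
    obtain ⟨nn, hnn, hcomm, hw'⟩ := (hss.2.2 w).2
    rw [hw', map_add]
    exact Matrix.charpoly_add_eq_of_isNilpotent_of_commute (hnn.map LinearMap.toMatrixAlgEquiv')
      (hcomm.symm.map LinearMap.toMatrixAlgEquiv')
  -- (γ) conjugation by `e`
  have hγ : (LinearMap.toMatrix' (S.ρ w)).charpoly = (LinearMap.toMatrix' (rss.ρ w)).charpoly := by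
    rw [charpoly_toMatrix'_eq, charpoly_toMatrix'_eq, ← Representation.Equiv.conj_apply_self w e, LinearEquiv.charpoly_conj]
  -- (δ) the exact `q`-pair of `[S.ρ w]` over `ℂ`
  set A : Matrix (Fin n) (Fin n) ℂ := LinearMap.toMatrix' (S.ρ w) with hA
  set Nm : Matrix (Fin n) (Fin n) ℂ := LinearMap.toMatrix' S.N with hNm
  have hNm0 : Nm ≠ 0 := fun h => hNS ((LinearEquiv.map_eq_zero_iff LinearMap.toMatrix').mp h)
  have hAN : A * Nm = (q : ℂ) • (Nm * A) := toMatrix'_rel_of_deg_one S hw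
  have hAunit : IsUnit A := isUnit_toMatrix'_ρ S w
  have hq0 : (q : ℂ) ≠ 0 := Nat.cast_ne_zero.mpr (by omega)
  obtain ⟨μ, hμ0, hμ, hqμ⟩ := exists_root_pair A Nm hAunit hNm0 hq0 hAN
  -- (ε) pull the pair back along `ι`
  have hApι : A.charpoly = p.map (ι : PadicAlgCl ℓ →+* ℂ) := by rw [hA, hγ, ← hβ, hα]
  have hroot : ∀ z : ℂ, A.charpoly.IsRoot z → p.IsRoot (ι.symm z) := by
    intro z hz
    rw [hApι, Polynomial.IsRoot.def] at hz
    have h1 : (p.map (ι : PadicAlgCl ℓ →+* ℂ)).eval ((ι : PadicAlgCl ℓ →+* ℂ) (ι.symm z)) =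
        (ι : PadicAlgCl ℓ →+* ℂ) (p.eval (ι.symm z)) := by
      rw [Polynomial.eval_map, Polynomial.eval₂_hom]
    have h2 : (ι : PadicAlgCl ℓ →+* ℂ) (ι.symm z) = z := by simp
    rw [← h2, h1] at hz
    exact (map_eq_zero_iff _ (ι : PadicAlgCl ℓ →+* ℂ).injective).mp hz
  have hb0 : ι.symm μ ≠ 0 := (map_ne_zero_iff _ ι.symm.injective).mpr hμ0
  have hqE1 : (q : PadicAlgCl ℓ) ≠ 1 := by exact_mod_cast hq1.ne'
  have hne : (q : PadicAlgCl ℓ) * ι.symm μ ≠ ι.symm μ := fun h => hqE1 ((mul_eq_right₀ hb0).mp h)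
  refine ⟨(q : PadicAlgCl ℓ) * ι.symm μ, ι.symm μ, pair_le_roots hp0 ?_ (hroot μ hμ) hne, by rw [hqdef, residueFieldCard_adicCompletion_eq]⟩
  have : ι.symm ((q : ℂ) * μ) = (q : PadicAlgCl ℓ) * ι.symm μ := by rw [map_mul, map_natCast]
  rw [← this]
  exact hroot _ hqμ

/-- **THE SEMISIMPLE EDGE: `S5 ⟸ CRD ∧ P(i) ∧ SSM ∧ IWD-A ∧ IWD-B1a ∧ IWD-B1b ∧ IWD-B2`.**  As `iwahoriDictionary_of_host`, with the
full local–global compatibility L∤R (18084) replaced by its Weil-group half SSM = `RootDecomp1.SemisimpleMatchingOneDatum` (23600: a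
Frobenius-semisimple `S ∈ rec_v(π_v)` with the traces of `ι WD_v(ρ')` at the exceptional places); at the Satake-compatible places only TREE
THEOREMS are used (Flath existence from Harish-Chandra finiteness, `hasLocalComponentAt_spherical_of_hasSatakeParamAt_holds`, `iwahoriGL ≤ GL_n(𝒪_v)`).  The monodromy half of L∤R is not needed: where
S5 asks about monodromy (`q_v`-pairs) the Galois side supplies it (§A, §D), and where both monodromies vanish the trace identity upgrades to
full compatibility at `v` by Brauer–Nesbitt.  [new] -/
theorem iwahoriDictionary_of_ssHost (hCRD : CanonicalReciprocityData) (hP : PadicMemberCompatibility)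
    (hSSM : Summit.Langlands.Langlands.Theses.RootDecomp1.SemisimpleMatchingOneDatum)
    (hA : IwahoriFixedOfInertiaTrivialParameter) (hB1a : SphericalOfUnramifiedParameter)
    (hB1b : UnramifiedOfSphericalLocalComponent) (hB2 : SatakeOfSphericalLocalGlobal) : IwahoriDictionary := by
  intro K _ _ n hcpt hn π hL ℓ _ ι ρ' hirr hcompat v hvℓ hunip
  by_cases hsat : Summit.Langlands.SatakeFrobCompatibleAt ι π.1 ρ' v
  · -- a Satake-compatible place: local component by Flath, spherical vector by the tree, Iwahori ≤ GL_n(𝒪_v)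
    refine ⟨?_, Or.inl hsat⟩
    obtain ⟨α, hα, -, -⟩ := hsat
    -- Flath existence of the local component is a TREE THEOREM: Borel–Jacquet admissibility (Harish-Chandra finiteness, proved) + `exists_hasLocalComponentAt_of_isAdmissible`
    obtain ⟨πv, hloc⟩ := AutomorphicRepData.exists_hasLocalComponentAt_of_isAdmissible (automorphicRep_isAdmissible_holds hcpt) π.1 v
    obtain ⟨x, hx0, hx⟩ := AutomorphicRepData.hasLocalComponentAt_spherical_of_hasSatakeParamAt_holds π.1 v α πv hα hloc
    exact ⟨πv, hloc, x, hx0, fun g hg =>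
      hx g ((mem_range_map_adicCompletionIntegers_iff_mem_glInt n v g).2 (iwahoriGL_le_glInt n _ hg))⟩
  -- an exceptional place: the semisimple matching partner `S`
  have hgeom : (∀ᶠ w : HeightOneSpectrum (NumberField.RingOfIntegers K) in Filter.cofinite, ρ'.IsUnramifiedAt w) ∧
      ∀ (w : HeightOneSpectrum (NumberField.RingOfIntegers K)) (hw : ((ℓ : ℕ) : NumberField.RingOfIntegers K) ∈ w.asIdeal),
        (Literature.NumberTheory.PAdicHodge.fontainePstAdicCompletion w ℓ hw).IsDeRhamFramed (ρ'.toLocal w) :=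
    ⟨hcompat.mono fun w hw => by
        obtain ⟨α, -, hur, -⟩ := hw
        exact hur,
     fun w hw => (hP K n hcpt hn π hL ℓ ι ρ' hirr hcompat w hw).1⟩
  obtain ⟨Rec, hRec⟩ := hSSM K (hCRD K)
  obtain ⟨πv, W, Wℂ, S, hS, hloc, hWD, htrans, hcl, htr⟩ := hRec n hcpt hn π hL ℓ ι ρ' hirr hgeom hcompat v hvℓ hsat
  have hunipW := weil_inertia_unipotent ρ' v hunip
  have hI : WeilGroup.IsUnramifiedRep W.ρ := wd_inertia_eq_one _ W hWD hunipW
  have hIℂ : WeilGroup.IsUnramifiedRep Wℂ.ρ := htrans.isUnramifiedRep hI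
  -- Frobenius-semisimplify `Wℂ` and compare with `S` by traces (Brauer–Nesbitt)
  obtain ⟨rss, hss⟩ := WeilDeligneRep.exists_isFrobSemisimplificationOf Wℂ
  have htr' : ∀ x : WeilGroup (v.adicCompletion K),
      LinearMap.trace ℂ (Fin n → ℂ) (rss.ρ x) = LinearMap.trace ℂ (Fin n → ℂ) (S.ρ x) := by
    intro x
    obtain ⟨nn, hnn, -, hx⟩ := (hss.2.2 x).2
    rw [← htr x, hx, map_add, (LinearMap.isNilpotent_trace_of_isNilpotent hnn).eq_zero, add_zero]
  obtain ⟨e⟩ := WeilDeligneRep.nonempty_equiv_of_isFrobSemisimple_of_trace_eq hss.isFrobSemisimple hS htr'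
  have hIss : WeilGroup.IsUnramifiedRep rss.ρ := fun u hu => (hss.2.1 u hu).trans (hIℂ u hu)
  have hIS : WeilGroup.IsUnramifiedRep S.ρ := by
    intro u hu
    have h := Representation.Equiv.conj_apply_self u e
    rw [hIss u hu, Module.End.one_eq_id, LinearEquiv.conj_id] at h
    rw [Module.End.one_eq_id]
    exact h.symm
  refine ⟨⟨πv, hloc, hA K Rec n hcpt π v πv S hS hloc hIS hcl.symm⟩, Or.inr ?_⟩
  intro 𝔓 h𝔓 σ hσ
  by_cases hNW : W.N = 0
  · by_cases hNS : S.N = 0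
    · -- both monodromies vanish: full compatibility at `v`, hence Satake compatibility — the place was not exceptional
      exfalso
      have hrssN : rss.N = 0 := hss.1.trans (htrans.N_eq_zero hNW)
      have hEq : rss.IsEquivalent S := ⟨⟨e, by rw [hrssN, hNS, LinearMap.comp_zero, LinearMap.zero_comp]⟩⟩
      have hpst : Wℂ.HasFrobSemisimpleClass ((Rec.llc v).recGL n (IrrClass.mk πv)) :=
        ⟨rss, hss, by rw [← hcl]; exact Quotient.sound hEq⟩
      have hLGC : Summit.Langlands.LocalGlobalCompatibleAt Rec ι π.1 ρ' v :=
        ⟨πv, W, Wℂ, hloc, fun _ => hWD, fun hv => absurd hv hvℓ, htrans, hpst⟩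
      have hsph := hB1a K Rec n hcpt π v πv S hS hloc hNS hIS hcl.symm
      have hπv : π.1.IsUnramifiedAt v := hB1b K n hcpt π v πv hloc hsph
      exact hsat (hB2 n hn K Rec hcpt π ℓ ι ρ' v hvℓ hπv hLGC)
    · -- `N(WD) = 0 ≠ N_S`: the `q_v`-pair of `S` is a pair of roots of `charpoly ρ'(σ)`
      obtain ⟨w, hw1, hchar⟩ := charpoly_frob_eq_charpoly_weil ρ' v W hWD hI h𝔓 hσ
      obtain ⟨a, b, hab, hq⟩ := qpair_of_complex_partner ι W Wℂ rss S htrans hss e hNS hw1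
      exact ⟨a, b, by rw [hchar]; exact hab, hq⟩
  · exact qpair_of_N_ne_zero ρ' v W hWD hNW hI h𝔓 hσ

end SemisimpleHost

/-! ## §G. Compositions over the semisimple host -/

section CompositionSS

/-- **`SemistableShaping ⟸ W⁺ ∧ P ∧ SSM ∧ CRD ∧ IWD-A ∧ IWD-B1a ∧ IWD-B1b ∧ IWD-B2`** (ss-host version of `semistableShaping_of_host`). -/
theorem semistableShaping_of_ssHost
    (hW : Summit.Langlands.Langlands.Theses.PrimeSwitchSplit.SatakeAvatarExistence)
    (hP : Summit.Langlands.Langlands.Theses.PrimeSwitchSplit.PadicMemberCompatibility)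
    (hSSM : Summit.Langlands.Langlands.Theses.RootDecomp1.SemisimpleMatchingOneDatum)
    (hCRD : Summit.Langlands.Langlands.Theses.PrimeSwitchSplit.CanonicalReciprocityData)
    (hA : IwahoriFixedOfInertiaTrivialParameter) (hB1a : SphericalOfUnramifiedParameter)
    (hB1b : UnramifiedOfSphericalLocalComponent) (hB2 : SatakeOfSphericalLocalGlobal) :
    Summit.Langlands.Langlands.Theorems.IwahoriTransient.SemistableShaping :=
  semistableShaping_of hW
    (fun K _ _ n hcpt π => Literature.NumberTheory.Automorphic.AutomorphicRepData.hasSatakeParamAt_unique_holds π.1)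
    (iwahoriDictionary_of_ssHost hCRD hP hSSM hA hB1a hB1b hB2)

/-- … and U = `AuxiliaryLevelSplit.LevelFiniteness` (27042) with ILC, through the tree's `closes_target`. -/
theorem levelFiniteness_of_ssHost
    (hW : Summit.Langlands.Langlands.Theses.PrimeSwitchSplit.SatakeAvatarExistence)
    (hP : Summit.Langlands.Langlands.Theses.PrimeSwitchSplit.PadicMemberCompatibility)
    (hSSM : Summit.Langlands.Langlands.Theses.RootDecomp1.SemisimpleMatchingOneDatum)
    (hCRD : Summit.Langlands.Langlands.Theses.PrimeSwitchSplit.CanonicalReciprocityData)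
    (hA : IwahoriFixedOfInertiaTrivialParameter) (hB1a : SphericalOfUnramifiedParameter)
    (hB1b : UnramifiedOfSphericalLocalComponent) (hB2 : SatakeOfSphericalLocalGlobal)
    (hILC : Summit.Langlands.Langlands.Theorems.IwahoriTransient.IwahoriLevelConfinement) :
    Summit.Langlands.Langlands.Theses.AuxiliaryLevelSplit.LevelFiniteness :=
  closes_target (semistableShaping_of_ssHost hW hP hSSM hCRD hA hB1a hB1b hB2) hILC

end CompositionSS

end DictEdge

end Summit.Langlands.Langlands.Theorems.IwahoriTransient

#print axioms Summit.Langlands.Langlands.Theorems.IwahoriTransient.DictEdge.iwahoriDictionary_of_ssHost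
#print axioms Summit.Langlands.Langlands.Theorems.IwahoriTransient.DictEdge.semistableShaping_of_ssHost
#print axioms Summit.Langlands.Langlands.Theorems.IwahoriTransient.DictEdge.levelFiniteness_of_ssHost
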